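import Mathlib
import Summits.NavierStokesRegularity.FluidComputer.AbcClassIIX0
import Summits.NavierStokesRegularity.FluidComputer.AbcClassIIEnergy

/-!
# Class-II layer of the skew-cut X0 chain, Part G: Bessel on the orbits, `ℓ²` growth of `Π X`, and the
# graph bound of Galerkin eigenvectors from the eigen-equation alone
(instab4 g6 — implementation 2 of the skew-cut X0 certifier, cell `ns-blowup`, 2026-08-27)

HONEST FRAMING (human ruling D-0035): nothing here is a claim about Navier–Stokes blow-up.
WHAT THIS IS NOT: not NS evidence. MODEL lane. Second half of residue (A1) of `AbcClassIIX0`: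

* `sum_sq_pairing_le` — BESSEL on the orbits of a cube (`Orthonormal.sum_inner_products_le` for the
  coerced orbit bases in the Euclidean spaces of the orbits);
* `sum_norm_sq_lerayCrossForm_section_le` — `ℓ²` GROWTH: `Σ_k ‖Π_k X ṽ(k)‖² ≤ 2916 Σ_j (1+|O_j|²)|v_j|²`
  for a section combination `ṽ` (`AbcClassIIIndex.norm_lerayCrossForm_le`, Cauchy–Schwarz, translation);
* `graph_bound_section` — a real Galerkin eigenvector with eigenvalue `x`, `Σv² = 1`, has
  `Σ_i (1 + |O_i|²/R)² v_i² ≤ 2(1 − x)² + 5832(1 + R(√2 − x))` (with the ENERGY bound of `AbcClassIIEnergy`);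
* **`isLinNSEigenvalue_of_section_eigenpairs'`** — the END-TO-END statement of `AbcClassIIX0` with the
  graph-bound hypothesis REMOVED: real Galerkin section eigenpairs of `[−(|O|²/R)δ + amat]` on
  `cubeIdx (K₀ + n)` with eigenvalues in `[x₁, x₂]`, `Σ v² = 1`, for every `n`
  ⇒ `∃ λ ∈ [x₁, x₂]`, `Torus.IsLinNSEigenvalue (1/(2πR)) (abcFlow 1 1 1) (2πλ)`.

After this file the inputs of the kernel chain are exactly the outputs of instab3's
`SkewCutSchurCoercivity.exists_eigenvalue_of_certificate` (normalised), i.e. what the certificates'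
transcribed head signs / shell numbers / tail constants give once the section matrices in the basis
`bfam` are fed to it (residue (A2), `AbcClassIISections`). Mathlib + the files named; no new definitions.
-/

noncomputable section

open scoped BigOperators ComplexConjugate InnerProductSpace
open Finset MeasureTheory UnitAddTorus

namespace Summit.NavierStokesRegularity.FluidComputer.AbcClassII

open Literature.Analysis.FunctionSpaces Literature.Analysis.FunctionSpaces.Torus
open Literature.Analysis.FunctionSpaces.EuclideanSpace
open Literature.Analysis.FluidPDE Literature.Analysis.FluidPDE.SteadyLattice
open Literature.Analysis.FluidPDE.ScalarFourier

/-! ## Part G. Bessel on the orbits, `ℓ²` growth of `Π X`, the graph bound from the eigen-equation (instab4 g6) -/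

section GraphBound

/-- The norm of a restriction: `‖restrictTo S g‖² = Σ_{k ∈ S} ‖g k‖²`. -/
theorem norm_sq_restrictTo (S : Finset (Fin 3 → ℤ)) (g : Fam) :
    ‖restrictTo S g‖ ^ 2 = ∑ k ∈ S, ‖g k‖ ^ 2 := by
  rw [EuclideanSpace.norm_sq_eq, Fintype.sum_prod_type, ← Finset.sum_coe_sort S]
  refine Finset.sum_congr rfl fun k _ => ?_
  rw [EuclideanSpace.norm_sq_eq]
  rfl

/-- The coerced orbit basis is complex-orthonormal in the Euclidean space of the orbit. -/
theorem orthonormal_orbitBasis_coe (O : Orbit) :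
    Orthonormal ℂ (fun a : Fin (odim O) => ((orbitBasis O a : realSpace O.1) : EuclideanSpace ℂ (↥O.1 × Fin 3))) := by
  rw [orthonormal_iff_ite]
  intro a a'
  rw [inner_coe_realSpace (neg_mem_of_orbitClosed O.orbitClosed) (orbitBasis O a) (orbitBasis O a'),
    orthonormal_iff_ite.mp (orbitBasis O).orthonormal a a']
  split_ifs <;> simp

/-- Pairings against basis families as Euclidean inner products on the orbit:
`Σ_{k ∈ O} ⟪bfam ⟨O,a⟩ k, g k⟫ = ⟪orbitBasis O a, restrictTo O g⟫`. -/
theorem sum_inner_bfam_eq_inner_restrictTo (O : Orbit) (a : Fin (odim O)) (g : Fam) :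
    ∑ k ∈ O.1, (inner ℂ (bfam ⟨O, a⟩ k) (g k) : ℂ) =
      inner ℂ ((orbitBasis O a : realSpace O.1) : EuclideanSpace ℂ (↥O.1 × Fin 3)) (restrictTo O.1 g) := by
  rw [inner_eq_sum_extend]
  refine Finset.sum_congr rfl fun k hk => ?_
  rw [bfam_eq]
  congr 1
  ext p
  rw [extend_apply_of_mem _ hk]
  rfl

/-- **Bessel on the orbits of a cube**: for any family `g`,
`Σ_{i ∈ cubeIdx n} |Σ_{k ∈ O_i} ⟪bfam i k, g k⟫|² ≤ Σ_{k ∈ cube n ∖ 0} ‖g k‖²`. -/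
theorem sum_sq_pairing_le (n : ℕ) (g : Fam) :
    ∑ i ∈ cubeIdx n, ‖∑ k ∈ i.1.1, (inner ℂ (bfam i k) (g k) : ℂ)‖ ^ 2 ≤
      ∑ k ∈ (cube n).filter (fun k => k ≠ 0), ‖g k‖ ^ 2 := by
  rw [sum_cubeIdx_eq n (fun i => ‖∑ k ∈ i.1.1, (inner ℂ (bfam i k) (g k) : ℂ)‖ ^ 2), sum_cube_filter_eq]
  refine Finset.sum_le_sum fun O _ => ?_
  calc ∑ a : Fin (odim O), ‖∑ k ∈ O.1, (inner ℂ (bfam ⟨O, a⟩ k) (g k) : ℂ)‖ ^ 2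
      = ∑ a : Fin (odim O), ‖inner ℂ ((orbitBasis O a : realSpace O.1) : EuclideanSpace ℂ (↥O.1 × Fin 3))
          (restrictTo O.1 g)‖ ^ 2 := Finset.sum_congr rfl fun a _ => by rw [sum_inner_bfam_eq_inner_restrictTo]
    _ ≤ ‖restrictTo O.1 g‖ ^ 2 := (orthonormal_orbitBasis_coe O).sum_inner_products_le _
    _ = ∑ k ∈ O.1, ‖g k‖ ^ 2 := norm_sq_restrictTo O.1 g

/-- Sums of a non-negative function vanishing off `S`, over any finite set, are at most its sum over `S`. -/
theorem sum_le_sum_of_support {S T : Finset (Fin 3 → ℤ)} {h : (Fin 3 → ℤ) → ℝ} (h0 : ∀ k, 0 ≤ h k)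
    (hS : ∀ k ∉ S, h k = 0) : ∑ k ∈ T, h k ≤ ∑ k ∈ S, h k := by
  classical
  have e : ∑ k ∈ T, h k = ∑ k ∈ T.filter (fun k => k ∈ S), h k := by
    rw [Finset.sum_filter]
    refine Finset.sum_congr rfl fun k _ => ?_
    by_cases hk : k ∈ S
    · rw [if_pos hk]
    · rw [if_neg hk, hS k hk]
  rw [e]
  exact Finset.sum_le_sum_of_subset_of_nonneg (fun k hk => (Finset.mem_filter.mp hk).2) fun k _ _ => h0 k

/-- Weighted Parseval on the orbits of a section combination:
`Σ_{k ∈ cube n∖0} (1+|k|²) ‖ṽ k‖² = Σ_{j ∈ cubeIdx n} (1+|O_j|²) |v_j|²`. -/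
theorem sum_weight_norm_sq_section (n : ℕ) (v : Idx → ℂ) :
    ∑ k ∈ (cube n).filter (fun k => k ≠ 0), (1 + freqNormSq k) * ‖(∑ j ∈ cubeIdx n, v j • bfam j) k‖ ^ 2 =
      ∑ j ∈ cubeIdx n, (1 + onormSq j.1) * ‖v j‖ ^ 2 := by
  rw [sum_cube_filter_eq, sum_cubeIdx_eq n (fun j => (1 + onormSq j.1) * ‖v j‖ ^ 2)]
  refine Finset.sum_congr rfl fun O hO => ?_
  have horb : ∀ k ∈ O.1, (∑ j ∈ cubeIdx n, v j • bfam j) k =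
      (∑ a : Fin (odim O), v ⟨O, a⟩ • bfam ⟨O, a⟩) k := by
    intro k hk
    rw [sum_smul_bfam_apply (cubeIdx n) (fun j => j) v k, Finset.sum_apply]
    have e : (∑ j ∈ cubeIdx n, v j • bfam j k) =
        ∑ O' ∈ cubeOrbits n, ∑ a : Fin (odim O'), v ⟨O', a⟩ • bfam ⟨O', a⟩ k :=
      Finset.sum_sigma (cubeOrbits n) (fun O' => (Finset.univ : Finset (Fin (odim O')))) (fun j => v j • bfam j k)
    rw [e, Finset.sum_eq_single O]
    · rfl
    · intro O' _ hne
      refine Finset.sum_eq_zero fun a _ => ?_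
      have hnot : k ∉ O'.1 := fun h => hne (Subtype.ext ((O'.sgnOrbit_eq h).symm.trans (O.sgnOrbit_eq hk)))
      rw [bfam_apply_of_not_mem ⟨O', a⟩ hnot, smul_zero]
    · intro hnot; exact absurd hO hnot
  calc ∑ k ∈ O.1, (1 + freqNormSq k) * ‖(∑ j ∈ cubeIdx n, v j • bfam j) k‖ ^ 2
      = ∑ k ∈ O.1, (1 + onormSq O) * ‖(∑ a : Fin (odim O), v ⟨O, a⟩ • bfam ⟨O, a⟩) k‖ ^ 2 :=
        Finset.sum_congr rfl fun k hk => by rw [O.freqNormSq_eq hk, horb k hk]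
    _ = (1 + onormSq O) * ∑ a : Fin (odim O), ‖v ⟨O, a⟩‖ ^ 2 := by
        rw [← Finset.mul_sum, sum_norm_sq_orbitExpansion]
    _ = ∑ a : Fin (odim O), (1 + onormSq O) * ‖v ⟨O, a⟩‖ ^ 2 := by rw [Finset.mul_sum]
    _ = _ := Finset.sum_congr rfl fun a _ => rfl

/-- **`ℓ²` growth of `Π X` on a section combination**: for `ṽ = Σ_{j ∈ cubeIdx n} v_j bfam j` and any
finite set `T` of frequencies, `Σ_{k ∈ T} ‖Π_k X ṽ(k)‖² ≤ 2916 Σ_j (1 + |O_j|²) |v_j|²`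
(`‖Π_k X c(k)‖ ≤ 9 Σ_y ⟨k−q_y⟩‖c(k−q_y)‖`, Cauchy–Schwarz over the six shell vectors, translation). -/
theorem sum_norm_sq_lerayCrossForm_section_le (n : ℕ) (v : Idx → ℂ) (T : Finset (Fin 3 → ℤ)) :
    ∑ k ∈ T, ‖Torus.lerayCoeff k (crossForm 1 1 1 (∑ j ∈ cubeIdx n, v j • bfam j) k)‖ ^ 2 ≤
      2916 * ∑ j ∈ cubeIdx n, (1 + onormSq j.1) * ‖v j‖ ^ 2 := by
  classical
  set c : Fam := ∑ j ∈ cubeIdx n, v j • bfam j with hc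
  set S := (cube n).filter (fun k => k ≠ 0) with hS
  set h : (Fin 3 → ℤ) → ℝ := fun m => (1 + freqNormSq m) * ‖c m‖ ^ 2 with hh
  have h0 : ∀ m, 0 ≤ h m := fun m => mul_nonneg (by linarith [freqNormSq_nonneg m]) (sq_nonneg _)
  have hsupp : ∀ m ∉ S, h m = 0 := fun m hm => by
    simp only [hh]; rw [hc, sectionFam_eq_zero_of_not_mem v hm, norm_zero]; ring
  -- pointwise: ‖Π X c k‖² ≤ 81·6·Σ_y h(k − q_y)
  have hpt : ∀ k, ‖Torus.lerayCoeff k (crossForm 1 1 1 c k)‖ ^ 2 ≤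
      486 * ∑ y : Fin 3 × Bool, h (k - Torus.abcDir y) := by
    intro k
    have h1 := norm_lerayCrossForm_le c k
    have h2 : (∑ y : Fin 3 × Bool, sobolevWeight 1 (k - Torus.abcDir y) * ‖c (k - Torus.abcDir y)‖) ^ 2 ≤
        6 * ∑ y : Fin 3 × Bool, (sobolevWeight 1 (k - Torus.abcDir y) * ‖c (k - Torus.abcDir y)‖) ^ 2 := by
      have := sq_sum_le_card_mul_sum_sq (s := (Finset.univ : Finset (Fin 3 × Bool)))
        (f := fun y => sobolevWeight 1 (k - Torus.abcDir y) * ‖c (k - Torus.abcDir y)‖)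
      simpa using this
    have h3 : ∀ y : Fin 3 × Bool, (sobolevWeight 1 (k - Torus.abcDir y) * ‖c (k - Torus.abcDir y)‖) ^ 2 =
        h (k - Torus.abcDir y) := by
      intro y
      simp only [hh]
      rw [mul_pow, sobolevWeight_one_eq, Real.sq_sqrt (by linarith [freqNormSq_nonneg (k - Torus.abcDir y)])]
    rw [Finset.sum_congr rfl fun y _ => h3 y] at h2
    have hA : 0 ≤ ∑ y : Fin 3 × Bool, sobolevWeight 1 (k - Torus.abcDir y) * ‖c (k - Torus.abcDir y)‖ :=
      Finset.sum_nonneg fun y _ => mul_nonneg (sobolevWeight_pos 1 _).le (norm_nonneg _)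
    nlinarith [h1, h2, norm_nonneg (Torus.lerayCoeff k (crossForm 1 1 1 c k))]
  -- translation: Σ_{k ∈ T} h(k − q) ≤ Σ_{m ∈ S} h m
  have htr : ∀ q : Fin 3 → ℤ, ∑ k ∈ T, h (k - q) ≤ ∑ m ∈ S, h m := by
    intro q
    rw [← Finset.sum_image (f := h) (s := T) (g := fun k => k - q) (fun k _ k' _ hkk => sub_left_injective hkk)]
    exact sum_le_sum_of_support h0 hsupp
  calc ∑ k ∈ T, ‖Torus.lerayCoeff k (crossForm 1 1 1 c k)‖ ^ 2
      ≤ ∑ k ∈ T, 486 * ∑ y : Fin 3 × Bool, h (k - Torus.abcDir y) := Finset.sum_le_sum fun k _ => hpt k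
    _ = 486 * ∑ y : Fin 3 × Bool, ∑ k ∈ T, h (k - Torus.abcDir y) := by
        rw [← Finset.mul_sum, Finset.sum_comm]
    _ ≤ 486 * ∑ _y : Fin 3 × Bool, ∑ m ∈ S, h m := by
        refine mul_le_mul_of_nonneg_left (Finset.sum_le_sum fun y _ => htr _) (by norm_num)
    _ = 2916 * ∑ m ∈ S, h m := by simp; ring
    _ = 2916 * ∑ j ∈ cubeIdx n, (1 + onormSq j.1) * ‖v j‖ ^ 2 := by
        rw [hS, hh, hc, ← sum_weight_norm_sq_section n v]

/-- **GRAPH BOUND from the eigen-equation alone.** A real eigenvector `v` of the section matrix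
`−(|O|²/R)δ + amat` on `cubeIdx n` with eigenvalue `x` and `Σ v² = 1` satisfies
`Σ_i (1 + |O_i|²/R)² v_i² ≤ 2(1 − x)² + 5832 (1 + R(√2 − x))` (`R ≥ 1`). -/
theorem graph_bound_section {R : ℝ} (hR : 1 ≤ R) (n : ℕ) (v : Idx → ℝ) (x : ℝ)
    (heig : ∀ i ∈ cubeIdx n, -(onormSq i.1 / R) * v i + ∑ j ∈ cubeIdx n, amat i j * v j = x * v i)
    (hnorm : ∑ j ∈ cubeIdx n, v j ^ 2 = 1) :
    ∑ i ∈ cubeIdx n, (1 + onormSq i.1 / R) ^ 2 * v i ^ 2 ≤ 2 * (1 - x) ^ 2 + 5832 * (1 + R * (Real.sqrt 2 - x)) := by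
  classical
  have hR0 : 0 < R := by linarith
  set vc : Idx → ℂ := fun i => ((v i : ℝ) : ℂ) with hvc
  set c : Fam := ∑ j ∈ cubeIdx n, vc j • bfam j with hc
  -- energy: Σ κ v² ≤ R (√2 − x)
  have hE := energy_bound_section (R := R) n v x heig
  rw [hnorm, mul_one] at hE
  have hκ : ∑ i ∈ cubeIdx n, onormSq i.1 * v i ^ 2 ≤ R * (Real.sqrt 2 - x) := by
    have e : ∑ i ∈ cubeIdx n, (x + onormSq i.1 / R) * v i ^ 2 =
        x * ∑ i ∈ cubeIdx n, v i ^ 2 + R⁻¹ * ∑ i ∈ cubeIdx n, onormSq i.1 * v i ^ 2 := by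
      rw [Finset.mul_sum, Finset.mul_sum, ← Finset.sum_add_distrib]
      refine Finset.sum_congr rfl fun i _ => ?_
      rw [div_eq_inv_mul]; ring
    rw [hnorm, mul_one] at e
    rw [e] at hE
    have := mul_le_mul_of_nonneg_left (show R⁻¹ * ∑ i ∈ cubeIdx n, onormSq i.1 * v i ^ 2 ≤ Real.sqrt 2 - x by linarith) hR0.le
    rwa [← mul_assoc, mul_inv_cancel₀ hR0.ne', one_mul] at this
  -- (x + κ/R) v = Σ amat v = the pairing; Bessel + growth
  have hsq : ∑ i ∈ cubeIdx n, (x + onormSq i.1 / R) ^ 2 * v i ^ 2 ≤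
      2916 * ∑ j ∈ cubeIdx n, (1 + onormSq j.1) * v j ^ 2 := by
    have e1 : ∀ i ∈ cubeIdx n, (x + onormSq i.1 / R) ^ 2 * v i ^ 2 =
        ‖∑ k ∈ i.1.1, (inner ℂ (bfam i k) (Torus.lerayCoeff k (crossForm 1 1 1 c k)) : ℂ)‖ ^ 2 := by
      intro i hi
      rw [hc, sum_inner_bfam_lerayCrossForm_section (cubeIdx n) vc i]
      have h := congrArg (fun r : ℝ => (r : ℂ)) (heig i hi)
      push_cast at h
      have e : ∑ j ∈ cubeIdx n, ((amat i j : ℝ) : ℂ) * vc j = (((x + onormSq i.1 / R) * v i : ℝ) : ℂ) := by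
        simp only [hvc]; push_cast; linear_combination h
      rw [e, Complex.norm_real, Real.norm_eq_abs, sq_abs]; ring
    rw [Finset.sum_congr rfl e1]
    refine (sum_sq_pairing_le n _).trans ?_
    refine (sum_norm_sq_lerayCrossForm_section_le n vc _).trans ?_
    refine le_of_eq ?_
    congr 1
    refine Finset.sum_congr rfl fun j _ => ?_
    simp only [hvc, Complex.norm_real, Real.norm_eq_abs, sq_abs]
  -- assemble
  have h1 : ∑ j ∈ cubeIdx n, (1 + onormSq j.1) * v j ^ 2 ≤ 1 + R * (Real.sqrt 2 - x) := by
    rw [Finset.sum_congr rfl fun j _ => show (1 + onormSq j.1) * v j ^ 2 = v j ^ 2 + onormSq j.1 * v j ^ 2 by ring,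
      Finset.sum_add_distrib, hnorm]
    linarith
  have h2 : ∀ i ∈ cubeIdx n, (1 + onormSq i.1 / R) ^ 2 * v i ^ 2 ≤
      2 * ((1 - x) ^ 2 * v i ^ 2) + 2 * ((x + onormSq i.1 / R) ^ 2 * v i ^ 2) := by
    intro i _
    nlinarith [sq_nonneg (v i), sq_nonneg ((1 - x) - (x + onormSq i.1 / R)), sq_nonneg (v i * ((1 - x) - (x + onormSq i.1 / R)))]
  calc ∑ i ∈ cubeIdx n, (1 + onormSq i.1 / R) ^ 2 * v i ^ 2
      ≤ ∑ i ∈ cubeIdx n, (2 * ((1 - x) ^ 2 * v i ^ 2) + 2 * ((x + onormSq i.1 / R) ^ 2 * v i ^ 2)) :=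
        Finset.sum_le_sum h2
    _ = 2 * (1 - x) ^ 2 * ∑ i ∈ cubeIdx n, v i ^ 2 + 2 * ∑ i ∈ cubeIdx n, (x + onormSq i.1 / R) ^ 2 * v i ^ 2 := by
        rw [Finset.sum_add_distrib, ← Finset.mul_sum, ← Finset.mul_sum, ← Finset.mul_sum]; ring
    _ ≤ 2 * (1 - x) ^ 2 + 5832 * (1 + R * (Real.sqrt 2 - x)) := by
        rw [hnorm, mul_one]; nlinarith [hsq, h1]

/-- **END-TO-END from section eigenpairs alone** (the graph bound is now derived): real Galerkin section
eigenpairs of `[−(|O|²/R)δ + amat]` on `cubeIdx (K₀ + n)` with eigenvalues in `[x₁, x₂]` and `Σ v² = 1`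
for every `n` ⇒ `∃ λ ∈ [x₁, x₂]`, `Torus.IsLinNSEigenvalue (1/(2πR)) (abcFlow 1 1 1) (2πλ)`. -/
theorem isLinNSEigenvalue_of_section_eigenpairs' {R : ℝ} (hR : 1 ≤ R) (K₀ : ℕ) {x₁ x₂ : ℝ}
    (v : ℕ → Idx → ℝ) (xs : ℕ → ℝ) (hxs : ∀ n, xs n ∈ Set.Icc x₁ x₂)
    (heig : ∀ n, ∀ i ∈ cubeIdx (K₀ + n),
      -(onormSq i.1 / R) * v n i + ∑ j ∈ cubeIdx (K₀ + n), amat i j * v n j = xs n * v n i)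
    (hnorm : ∀ n, ∑ j ∈ cubeIdx (K₀ + n), v n j ^ 2 = 1) :
    ∃ lam ∈ Set.Icc x₁ x₂,
      Torus.IsLinNSEigenvalue (1 / (2 * Real.pi * R)) (Torus.abcFlow 1 1 1) ((2 * Real.pi * lam : ℝ) : ℂ) := by
  set B : ℝ := 2 * (1 + |x₁| + |x₂|) ^ 2 + 5832 * (1 + R * (Real.sqrt 2 + |x₁| + |x₂|)) with hB
  have hB0 : 0 ≤ B := by positivity
  refine isLinNSEigenvalue_of_section_eigenpairs hR K₀ v xs hxs heig hnorm (C := Real.sqrt B) (Real.sqrt_nonneg _)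
    fun n => ?_
  rw [Real.sq_sqrt hB0]
  refine (graph_bound_section hR (K₀ + n) (v n) (xs n) (heig n) (hnorm n)).trans ?_
  obtain ⟨h1, h2⟩ := hxs n
  have hx1 : (1 - xs n) ^ 2 ≤ (1 + |x₁| + |x₂|) ^ 2 := by
    have : |1 - xs n| ≤ 1 + |x₁| + |x₂| := by
      rcases le_or_gt 0 (1 - xs n) with h | h
      · rw [abs_of_nonneg h]; linarith [neg_le_abs x₁, abs_nonneg x₂]
      · rw [abs_of_neg h]; linarith [le_abs_self x₂, abs_nonneg x₁]
    nlinarith [abs_nonneg (1 - xs n), sq_abs (1 - xs n)]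
  have hx2 : Real.sqrt 2 - xs n ≤ Real.sqrt 2 + |x₁| + |x₂| := by linarith [neg_le_abs x₁, abs_nonneg x₂]
  have hR0 : 0 ≤ R := by linarith
  nlinarith [mul_le_mul_of_nonneg_left hx2 hR0]

end GraphBound

end Summit.NavierStokesRegularity.FluidComputer.AbcClassII

end
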